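import Literature.AlgebraicGeometry.RelativeSpec.DescentOfUnitAlongFreeQuotient
import Literature.AlgebraicGeometry.AbelianSchemes.AbelianSchemeQuotientBaseChangeAction
import Literature.AlgebraicGeometry.AbelianSchemes.AbelianSchemeConstSubgroupQuotientSmooth
import Literature.AlgebraicGeometry.AbelianSchemes.AbelianSchemeSteinOfReduced
import HarnessLib

/-!
# The `K`-character of a line bundle on `(A/K)_T` trivial on `A_T` (HECKE-LINK D6, stub (K4) «character step», part 1)

Layer `Literature/AlgebraicGeometry/AbelianSchemes`, namespace `Literature.AlgebraicGeometry.AbelianSchemes.AbelianSchemeOver`.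
THEOREMS ONLY (no definition, no named fact, no instance).

Setting ([MumfordAV1970] §7 Thm. 4, §12 Thm. 1, §15 Thm. 1): `A/S` an abelian scheme, `K ⊆ A(S)` a finite group of
sections acting freely by translations, killed by `n` (`hK`); `ψ : A → A/K` the quotient (★ `AbelianSchemeConstSubgroupQuotient`)
and, for a test base `T′ → S`, its base change `ψ_T : A_T → (A/K)_T` — a free affine flat geometric quotient for the
`K`-translations (★ (u0) `AbelianSchemeQuotientBaseChangeAction`).  Let `M` be a line bundle on `(A/K)_T` with
`τ : ψ_T^* M ≅ 𝒪_{A_T}`.  By descent along `ψ_T` ([MumfordAV1970] §12 Thm. 1; the kernel of `Pic (A/K)_T → Pic A_T` is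
`Hom(K, Γ(T, 𝒪_T)ˣ)`, [MumfordAV1970] §15, §23) the class of `M` is the CHARACTER `σ ↦ a_σ` by which `K` acts on the
generator `s = τ⁻¹(1)` of `ψ_T^* M`; its values are `n`-th roots of unity in `Γ(A_T, 𝒪) = Γ(T, 𝒪)` (Stein, ★
`AbelianSchemeSteinOfReduced`, `T` reduced).  If `M` is trivial on ONE fibre `(A/K)_k`, the character is `1` at that
point (the canonical linearisation of a trivial module has no twist, ★ `DescentOfUnitAlongFreeQuotient` §3–§4), hence
`1` on the CONNECTED `T` (★ `RootOfUnityRigidConnected`), hence `M ≅ 𝒪` (★ `DescentOfUnitAlongFreeQuotient` §2).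

* §0 generic junctions (variable action): unit and multiplication laws of the canonical action on `p^* F`;
* §1 plumbing over `T′`: flatness of `ψ_T`, `K` fixes the functions of `A_T` (Stein), the generator `s = τ⁻¹(1)` is an
  eigen-section of every `g ∈ K` (`g · s = a_g · s`), the eigen-relation is multiplicative and `a_g ^ n = 1`.
Part 2 (`AbelianSchemeQuotientDescentOfUnitRigid`): the fibre step and the theorem
`nonempty_iso_unit_of_pullback_quotientMk_iso_unit` (HECKE-LINK (K4); feeds the hypothesis `hChar` of ★
`PoincarePullbackStabilizerConstant.stabilizer_le_of_torsion_of_character` through (K5b)).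

Cell `hodgecm-mathlib` (D-0151), HECKE-LINK line card v1.2 / B-plan1 (g14) 21:39:01Z (P2) (K4).  Count-neutral; HC_CM is
proved only modulo the 7 printed citations until rung 0 closes — nothing here is about HC.

## References
* [MumfordAV1970] D. Mumford, *Abelian Varieties* (1970), §7 Thm. 4 (p. 72), §12 Thm. 1 (p. 112), §15 Thm. 1 (p. 143).
* [MilneAV2008] J. S. Milne, *Abelian Varieties* (2008), I §8 (pp. 36–37), I §9 Thm. 9.1 (p. 42).
* [SGA1] A. Grothendieck, SGA 1, Exp. I Cor. 5.4 (rigidity of étale sections).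
-/

set_option autoImplicit false

noncomputable section

-- `(A.X ⊗ T′).left = pullback A.X.hom T′.hom = (A.baseChange T′.hom).left` hold by `rfl` only.
set_option backward.isDefEq.respectTransparency false

universe u

open CategoryTheory CategoryTheory.Limits AlgebraicGeometry MonoidalCategory CartesianMonoidalCategory TopologicalSpace
  Opposite
open scoped MonObj

namespace Literature.AlgebraicGeometry.RelativeSpec.ActionOver

/-! ## §0 Generic junctions (variable action `ρ`): unit and multiplication laws of the canonical action on `p^* F`

Stated for a VARIABLE `ρ` so that the instantiation at the concrete translation action below is a syntactic match (feeding
`iso_one_hom`/`iso_mul_hom` of ★ `EquivariantStructure.ofPullback` to ★ `actSections_one`/`actSections_mul` at a concrete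
action whose automorphisms are long composites is a `whnf` cliff). -/

section Generic

variable {X Q : Scheme.{u}} {p : X ⟶ Q} {G : Type u} [Group G] (ρ : ActionOver p G) (F : Q.Modules)

/-- `1 · s = s` for the canonical action on sections of `p^* F`. [cite: MumfordAV1970, §7 Prop. 2 (p. 70)] -/
theorem actSections_ofPullback_one (V : Q.Opens) (s : Γ((Scheme.Modules.pullback p).obj F, p ⁻¹ᵁ V)) :
    ρ.actSections _ (EquivariantStructure.ofPullback ρ F).iso 1 V s = s :=
  ρ.actSections_one _ _ (EquivariantStructure.ofPullback ρ F).iso_one_hom V s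

/-- `(g h) · s = h · (g · s)` for the canonical action on sections of `p^* F`. [cite: MumfordAV1970, §7 Prop. 2 (p. 70)] -/
theorem actSections_ofPullback_mul (g h : G) (V : Q.Opens) (s : Γ((Scheme.Modules.pullback p).obj F, p ⁻¹ᵁ V)) :
    ρ.actSections _ (EquivariantStructure.ofPullback ρ F).iso (g * h) V s =
      ρ.actSections _ (EquivariantStructure.ofPullback ρ F).iso h V
        (ρ.actSections _ (EquivariantStructure.ofPullback ρ F).iso g V s) :=
  ρ.actSections_mul _ _ (EquivariantStructure.ofPullback ρ F).iso_mul_hom g h V s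

end Generic

end Literature.AlgebraicGeometry.RelativeSpec.ActionOver

namespace Literature.AlgebraicGeometry.AbelianSchemes.AbelianSchemeOver

open Literature.AlgebraicGeometry.RelativeSpec Literature.AlgebraicGeometry.Modules Literature.AlgebraicGeometry.Motives
  Literature.AlgebraicGeometry.HodgeTheory Literature.AlgebraicGeometry.Morphisms

variable {S : Scheme.{u}} (A : AbelianSchemeOver S) (T' : Over S) {Y : Scheme.{u}} (u : S ⟶ Y)
  (K : Subgroup A.Sections) {n : ℕ} (hK : ∀ σ : K, (σ : A.Sections) ^ n = 1)
  [Finite K] [Y.IsSeparated] [IsSeparated (A.X.hom ≫ u)] [S.IsSeparated]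
  (hcov : ∀ x : A.left, ∃ O : (A.translationActionOver u K).StableAffineOpens, x ∈ O.1)
  (hfree : ∀ (Ω : Type u) [Field Ω] [IsAlgClosed Ω] (x : Spec (.of Ω) ⟶ A.left) (σ : K), σ ≠ 1 →
    x ≫ (A.translation (σ : A.Sections)).left ≠ x)

/-! ## §1 Plumbing over the test base `T′` -/

include hfree in
/-- `ψ_T = ψ × 1 : A_T → (A/K)_T` is flat (base change of the flat ★ `flat_quotientMk_left` along ★
`isPullback_whiskerRight_left`). [cite: MumfordAV1970, §12 Thm. 1 (p. 112)] -/
theorem flat_whiskerRight_quotientMk_left [IsAffine Y] : Flat (A.quotientMk u K hcov ▷ T').left :=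
  haveI := A.flat_quotientMk_left u K hcov hfree
  MorphismProperty.of_isPullback
    (ActionOver.IsGeometricQuotient.isPullback_whiskerRight_left (A.quotientMk u K hcov) T') ‹_›

/-- **The `K`-translations fix the global functions of `A_T`** for `T′` reduced and locally Noetherian: every global
function of `A_T` comes from `T′` (★ `appTop_bijective_of_isReduced`, Stein), i.e. from `(A/K)_T` along `ψ_T`
(`ψ_T ≫ pr = pr`), and such functions are fixed (★ `appLE_aut_app`). [cite: MumfordAV1970, §12 Thm. 1 (p. 112)] -/
theorem appLE_translationWhiskerRight_eq_self [IsReduced T'.left] [IsLocallyNoetherian T'.left] (g : K)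
    (b : Γ((A.X ⊗ T').left, (A.quotientMk u K hcov ▷ T').left ⁻¹ᵁ ⊤)) :
    ((translationActionOverWhiskerRight A T' u K hcov).aut g).hom.appLE
        ((A.quotientMk u K hcov ▷ T').left ⁻¹ᵁ ⊤) ((A.quotientMk u K hcov ▷ T').left ⁻¹ᵁ ⊤)
        ((translationActionOverWhiskerRight A T' u K hcov).preimage_preimage g ⊤).ge b = b := by
  -- `b = pr_T^♯ c = ψ_T^♯ (pr^♯ c)`
  obtain ⟨c, hc⟩ := ((A.baseChange T'.hom).appTop_bijective_of_isReduced).2 b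
  have hb : b = (A.quotientMk u K hcov ▷ T').left.app ⊤ ((pullback.snd (A.quotientOver u K).hom T'.hom).appTop c) := by
    rw [← hc]
    change _ = ((A.quotientMk u K hcov ▷ T').left ≫ pullback.snd (A.quotientOver u K).hom T'.hom).appTop c
    rw [Over.whiskerRight_left_snd]
    rfl
  rw [hb]
  exact (translationActionOverWhiskerRight A T' u K hcov).appLE_aut_app g ⊤ _

section Character

variable (M : ((A.quotientOver u K ⊗ T').left).Modules)
  (τ : (Scheme.Modules.pullback (A.quotientMk u K hcov ▷ T').left).obj M ≅ SheafOfModules.unit _)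

/-- `τ(s) = 1` for the generator `s := τ⁻¹(1)` of `ψ_T^* M`. [cite: MumfordAV1970, §12 Thm. 1 (p. 112)] -/
theorem hom_app_inv_app_one :
    τ.hom.app ((A.quotientMk u K hcov ▷ T').left ⁻¹ᵁ ⊤)
        (τ.inv.app ((A.quotientMk u K hcov ▷ T').left ⁻¹ᵁ ⊤)
          (1 : Γ((A.X ⊗ T').left, (A.quotientMk u K hcov ▷ T').left ⁻¹ᵁ ⊤))) =
      (1 : Γ((A.X ⊗ T').left, (A.quotientMk u K hcov ▷ T').left ⁻¹ᵁ ⊤)) := by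
  rw [← CategoryTheory.comp_apply, ← Scheme.Modules.Hom.comp_app, Iso.inv_hom_id, Scheme.Modules.Hom.id_app]
  rfl

/-- `τ(b · s) = b` for the generator `s = τ⁻¹(1)`. [cite: MumfordAV1970, §12 Thm. 1 (p. 112)] -/
theorem hom_app_smul_inv_app_one (b : Γ((A.X ⊗ T').left, (A.quotientMk u K hcov ▷ T').left ⁻¹ᵁ ⊤)) :
    τ.hom.app ((A.quotientMk u K hcov ▷ T').left ⁻¹ᵁ ⊤)
        (b • τ.inv.app ((A.quotientMk u K hcov ▷ T').left ⁻¹ᵁ ⊤)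
          (1 : Γ((A.X ⊗ T').left, (A.quotientMk u K hcov ▷ T').left ⁻¹ᵁ ⊤))) = b := by
  rw [Scheme.Modules.Hom.app_smul, hom_app_inv_app_one]
  exact mul_one b

/-- **The generator `s = τ⁻¹(1)` is an eigen-section of every `g ∈ K`**: `g · s = a · s` for some global function `a`
(★ `exists_eq_smul_of_iso_unit`). [cite: MumfordAV1970, §12 Thm. 1 (p. 112)] -/
theorem exists_actSections_inv_app_one_eq_smul (g : K) :
    ∃ a : Γ((A.X ⊗ T').left, (A.quotientMk u K hcov ▷ T').left ⁻¹ᵁ ⊤),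
      (translationActionOverWhiskerRight A T' u K hcov).actSections _
          (ActionOver.EquivariantStructure.ofPullback (translationActionOverWhiskerRight A T' u K hcov) M).iso g ⊤
          (τ.inv.app ((A.quotientMk u K hcov ▷ T').left ⁻¹ᵁ ⊤)
            (1 : Γ((A.X ⊗ T').left, (A.quotientMk u K hcov ▷ T').left ⁻¹ᵁ ⊤))) =
        a • τ.inv.app ((A.quotientMk u K hcov ▷ T').left ⁻¹ᵁ ⊤)
          (1 : Γ((A.X ⊗ T').left, (A.quotientMk u K hcov ▷ T').left ⁻¹ᵁ ⊤)) :=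
  ActionOver.exists_eq_smul_of_iso_unit _ τ _ (by rw [hom_app_inv_app_one]; exact isUnit_one) _

variable [IsReduced T'.left] [IsLocallyNoetherian T'.left]

/-- **The eigen-relation is multiplicative**: `g · s = a s`, `h · s = b s` ⇒ `(gh) · s = (a b) s` — the cocycle
condition for the TRIVIAL action of `K` on `Γ(A_T, 𝒪) = Γ(T, 𝒪)`. [cite: MumfordAV1970, §15 Thm. 1 (p. 143)] -/
theorem actSections_mul_inv_app_one (g h : K) (a b : Γ((A.X ⊗ T').left, (A.quotientMk u K hcov ▷ T').left ⁻¹ᵁ ⊤))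
    (ha : (translationActionOverWhiskerRight A T' u K hcov).actSections _
        (ActionOver.EquivariantStructure.ofPullback (translationActionOverWhiskerRight A T' u K hcov) M).iso g ⊤
        (τ.inv.app ((A.quotientMk u K hcov ▷ T').left ⁻¹ᵁ ⊤)
          (1 : Γ((A.X ⊗ T').left, (A.quotientMk u K hcov ▷ T').left ⁻¹ᵁ ⊤))) =
      a • τ.inv.app ((A.quotientMk u K hcov ▷ T').left ⁻¹ᵁ ⊤)
        (1 : Γ((A.X ⊗ T').left, (A.quotientMk u K hcov ▷ T').left ⁻¹ᵁ ⊤)))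
    (hb : (translationActionOverWhiskerRight A T' u K hcov).actSections _
        (ActionOver.EquivariantStructure.ofPullback (translationActionOverWhiskerRight A T' u K hcov) M).iso h ⊤
        (τ.inv.app ((A.quotientMk u K hcov ▷ T').left ⁻¹ᵁ ⊤)
          (1 : Γ((A.X ⊗ T').left, (A.quotientMk u K hcov ▷ T').left ⁻¹ᵁ ⊤))) =
      b • τ.inv.app ((A.quotientMk u K hcov ▷ T').left ⁻¹ᵁ ⊤)
        (1 : Γ((A.X ⊗ T').left, (A.quotientMk u K hcov ▷ T').left ⁻¹ᵁ ⊤))) :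
    (translationActionOverWhiskerRight A T' u K hcov).actSections _
        (ActionOver.EquivariantStructure.ofPullback (translationActionOverWhiskerRight A T' u K hcov) M).iso (g * h) ⊤
        (τ.inv.app ((A.quotientMk u K hcov ▷ T').left ⁻¹ᵁ ⊤)
          (1 : Γ((A.X ⊗ T').left, (A.quotientMk u K hcov ▷ T').left ⁻¹ᵁ ⊤))) =
      (a * b) • τ.inv.app ((A.quotientMk u K hcov ▷ T').left ⁻¹ᵁ ⊤)
        (1 : Γ((A.X ⊗ T').left, (A.quotientMk u K hcov ▷ T').left ⁻¹ᵁ ⊤)) := by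
  rw [(translationActionOverWhiskerRight A T' u K hcov).actSections_ofPullback_mul, ha, ActionOver.actSections_smul,
    A.appLE_translationWhiskerRight_eq_self T' u K hcov, hb, ← mul_smul]

omit [IsReduced T'.left] [IsLocallyNoetherian T'.left] in
/-- `1 · s = s`. [cite: MumfordAV1970, §12 Thm. 1 (p. 112)] -/
theorem actSections_one_inv_app_one :
    (translationActionOverWhiskerRight A T' u K hcov).actSections _
        (ActionOver.EquivariantStructure.ofPullback (translationActionOverWhiskerRight A T' u K hcov) M).iso 1 ⊤
        (τ.inv.app ((A.quotientMk u K hcov ▷ T').left ⁻¹ᵁ ⊤)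
          (1 : Γ((A.X ⊗ T').left, (A.quotientMk u K hcov ▷ T').left ⁻¹ᵁ ⊤))) =
      τ.inv.app ((A.quotientMk u K hcov ▷ T').left ⁻¹ᵁ ⊤)
        (1 : Γ((A.X ⊗ T').left, (A.quotientMk u K hcov ▷ T').left ⁻¹ᵁ ⊤)) :=
  (translationActionOverWhiskerRight A T' u K hcov).actSections_ofPullback_one M ⊤ _

set_option maxHeartbeats 400000 in
/-- Powers of the eigen-relation: `g · s = a s` ⇒ `g^m · s = a^m s`. [cite: MumfordAV1970, §15 Thm. 1 (p. 143)] -/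
theorem actSections_pow_inv_app_one (g : K) (a : Γ((A.X ⊗ T').left, (A.quotientMk u K hcov ▷ T').left ⁻¹ᵁ ⊤))
    (ha : (translationActionOverWhiskerRight A T' u K hcov).actSections _
        (ActionOver.EquivariantStructure.ofPullback (translationActionOverWhiskerRight A T' u K hcov) M).iso g ⊤
        (τ.inv.app ((A.quotientMk u K hcov ▷ T').left ⁻¹ᵁ ⊤)
          (1 : Γ((A.X ⊗ T').left, (A.quotientMk u K hcov ▷ T').left ⁻¹ᵁ ⊤))) =
      a • τ.inv.app ((A.quotientMk u K hcov ▷ T').left ⁻¹ᵁ ⊤)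
        (1 : Γ((A.X ⊗ T').left, (A.quotientMk u K hcov ▷ T').left ⁻¹ᵁ ⊤)))
    (m : ℕ) :
    (translationActionOverWhiskerRight A T' u K hcov).actSections _
        (ActionOver.EquivariantStructure.ofPullback (translationActionOverWhiskerRight A T' u K hcov) M).iso (g ^ m) ⊤
        (τ.inv.app ((A.quotientMk u K hcov ▷ T').left ⁻¹ᵁ ⊤)
          (1 : Γ((A.X ⊗ T').left, (A.quotientMk u K hcov ▷ T').left ⁻¹ᵁ ⊤))) =
      (a ^ m) • τ.inv.app ((A.quotientMk u K hcov ▷ T').left ⁻¹ᵁ ⊤)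
        (1 : Γ((A.X ⊗ T').left, (A.quotientMk u K hcov ▷ T').left ⁻¹ᵁ ⊤)) := by
  induction m with
  | zero => rw [pow_zero, pow_zero, one_smul]; exact A.actSections_one_inv_app_one T' u K hcov M τ
  | succ m ih => rw [pow_succ, pow_succ, A.actSections_mul_inv_app_one T' u K hcov M τ (g ^ m) g _ _ ih ha]

include hK in
/-- **The eigenvalue is an `n`-th root of unity**: `g · s = a s` with `K` killed by `n` ⇒ `a ^ n = 1`
(`s = g^n · s = a^n s`, and `s` generates). [cite: MumfordAV1970, §15 Thm. 1 (p. 143)] -/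
theorem pow_eq_one_of_actSections_eq_smul (g : K) (a : Γ((A.X ⊗ T').left, (A.quotientMk u K hcov ▷ T').left ⁻¹ᵁ ⊤))
    (ha : (translationActionOverWhiskerRight A T' u K hcov).actSections _
        (ActionOver.EquivariantStructure.ofPullback (translationActionOverWhiskerRight A T' u K hcov) M).iso g ⊤
        (τ.inv.app ((A.quotientMk u K hcov ▷ T').left ⁻¹ᵁ ⊤)
          (1 : Γ((A.X ⊗ T').left, (A.quotientMk u K hcov ▷ T').left ⁻¹ᵁ ⊤))) =
      a • τ.inv.app ((A.quotientMk u K hcov ▷ T').left ⁻¹ᵁ ⊤)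
        (1 : Γ((A.X ⊗ T').left, (A.quotientMk u K hcov ▷ T').left ⁻¹ᵁ ⊤))) :
    a ^ n = 1 := by
  have hgn : g ^ n = 1 := Subtype.ext ((SubmonoidClass.coe_pow g n).trans (hK g))
  have h := A.actSections_pow_inv_app_one T' u K hcov M τ g a ha n
  rw [hgn, A.actSections_one_inv_app_one T' u K hcov M τ] at h
  -- `s = a^n s`; apply `τ`
  have h' := congrArg (fun t => τ.hom.app ((A.quotientMk u K hcov ▷ T').left ⁻¹ᵁ ⊤) t) h
  simp only at h'
  rw [A.hom_app_inv_app_one T' u K hcov M τ, A.hom_app_smul_inv_app_one T' u K hcov M τ] at h'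
  exact h'.symm

end Character

end Literature.AlgebraicGeometry.AbelianSchemes.AbelianSchemeOver

end
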